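import Literature.NumberTheory.Rogawski1990.LocalTransferTransportPoint
import Literature.NumberTheory.Automorphic.UnitaryGroupOrbitalMeasureFamilyOfLocal
import Literature.NumberTheory.Rogawski1990.AdelicStableClassesProduct
import HarnessLib

/-!
# A class-indexed orbital measure family read at CONJUGATE points: `m.atPoint (k x k⁻¹) = (conj k)_* (m.atPoint x)` for invariant `m⟦x⟧`,
# and the a.e. normalisation `∃ S₀, IsNormalisedOff` at every adelic point that is `K_v`-conjugate to a normalised one almost everywhere
(Rogawski (1990), §4.3 p. 44: «measures normalised so that `K ∩ T` has measure one for almost all `v`»; Kottwitz (1986), Prop. 7.1: «`γ′_v` is conjugate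
to `γ` by an element of `K_v` for almost all `v`»; Gelbart (1975), (9.13))

Topic `NumberTheory/Automorphic`; namespaces `Literature.NumberTheory.Automorphic` (§1, generic) and `….UnitaryGroup` (§2).  THEOREMS ONLY: no definition,
no named fact, no instance, no notation, no `sorry`.  Cell `pub/hodgecm-mathlib`, ENGINE T1 (crux H413 = `stmt-HodgeConjecture-24833`), row O7 «singular
semisimple classes», SPEC-O7 (ix-s) v1.1 + erratum (E1): at SINGULAR classes the local orbital measure families are only ADMISSIBLE (non-zero, invariant, finite
on compacta) — `OrbitalMeasureFamily.IsCanonical` is not available there (unsatisfiable at split places) — and normalisation is pinned as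
`∃ S₀, UnitaryGroup.IsNormalisedOff …` at the RATIONAL classes.  The singular heads (★ `AdelicStableOrbitalEulerAtSingularClasses`, ★ K6-ζ
`AdelicStableOrbitalEulerDischargeG2Semisimple`, …) also read normalisation at every MATCHING ADÈLE (`hnorm`), an adelic point that is NOT rational but is
`K_v`-conjugate to the rational base point for almost all `v` (★ K6-α).  The ★ regular road (★ `CompactCoreLevelConj`, ★ `OrbitalMeasureFamilyTransport`)
moves normalisation to conjugates through CANONICITY; this file moves it through INVARIANCE alone:

* §1 (generic topological group `G`, `m : OrbitalMeasureFamily G`, `m⟦x⟧` invariant) `OrbitalMeasureFamily.atPoint_eq_map_cosetCongr` — ★ `atPoint y` is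
  `(cosetCongr φ)_* (m c)` for ANY inner `φ = conj q` with `φ (out c) = y` (the chosen conjugator `conjOut y` is invisible, ★
  `map_cosetCongr_centralizer_eq_of_inner`); **`OrbitalMeasureFamily.atPoint_conj_eq_map`** — `m.atPoint (k x k⁻¹) = (cosetCongr (conj k))_* (m.atPoint x)`;
  **`….atPoint_conj_apply_image_mk`** — `(m.atPoint (k x k⁻¹)) (π K) = (m.atPoint x) (π (k⁻¹ K k))`; **`….atPoint_conj_apply_image_mk_of_mem`** — for a
  subgroup `K ∋ k` the `π K`-masses at `x` and at `k x k⁻¹` AGREE.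
* §2 (`U(H)`, any `N`, any `H`; ★ `UnitaryGroup.IsNormalisedOff`) **`UnitaryGroup.isNormalisedOff_of_forall_exists_mem_conj`** — `IsNormalisedOff mG g S₀`, «`y_v =
  k g_v k⁻¹` with `k ∈ U(H)(𝒪_v)` for `v ∉ S₁`», «`mG v ⟦g_v⟧` invariant for `v ∉ S₂`» ⟹ `IsNormalisedOff mG y (S₀ ∪ S₁ ∪ S₂)`;
  **`UnitaryGroup.exists_isNormalisedOff_of_eventually_exists_mem_conj`** — the `∃ S₀` ∕ `∀ᶠ v in cofinite` packaging (the shape of the `hnormγ` ∕ `hnorm`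
  binders and of ★ K6-α's `…eventually_exists_mem_conj…` conclusions).
* §3 (ED. 2; `U(H)`, any `N`, any `H`) **`UnitaryGroup.exists_isNormalisedOff_toAdelic_of_isConj`** — the pin passes between RATIONAL CONJUGATES
  (`γ = r δ r⁻¹`, `r ∈ U(H)(L⁺)` integral a.e.); **`….exists_isNormalisedOff_toAdelic_of_forall_out`** ∕ **`…_of_isAdmissibleOn`** — a pin stated at the
  representatives `toAdelic (Quotient.out c)` of the rational classes serves every rational `γ` (invariance a.e., resp. class-local admissibility at `γ_v`).
The CM applications at semisimple classes (both sides of the comparison, and the transported family `mq := (ψ_v)_* mG v`) are the sequel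
`Rogawski1990/AdelicNormalisationSemisimple`.  HC_CM is proved only modulo the printed citations until rung 0 closes; this file is unconditional and cites
nothing printed beyond the normalisation convention.

## References
* [Rogawski1990] J. D. Rogawski, *Automorphic Representations of Unitary Groups in Three Variables*, Ann. of Math. Stud. 123 (1990), §4.3 p. 44.
* [Kottwitz1986] R. E. Kottwitz, *Stable trace formula: elliptic singular terms*, Math. Ann. 275 (1986), Prop. 7.1.
* [Gelbart1975] S. Gelbart, *Automorphic forms on adele groups*, Ann. of Math. Stud. 83 (1975), (9.13), §10 pp. 154–155.
-/

set_option autoImplicit false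

noncomputable section

open MeasureTheory Measure Set Filter NumberField IsDedekindDomain
open Literature.MeasureTheory.Group

namespace Literature.NumberTheory.Automorphic

open Literature.NumberTheory.Rogawski1990 (map_cosetCongr_centralizer_eq_of_inner cosetCongr_cosetCongr_centralizer)

/-! ## §1 `atPoint` at conjugate points, for an invariant class measure -/

section AtPointConj

variable {G : Type*} [Group G] [TopologicalSpace G] [IsTopologicalGroup G]
  [∀ γ : G, MeasurableSpace (G ⧸ Subgroup.centralizer ({γ} : Set G))] [∀ γ : G, BorelSpace (G ⧸ Subgroup.centralizer ({γ} : Set G))]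
  (m : OrbitalMeasureFamily G)

/-- **`atPoint` through ANY inner conjugator.**  For a class `c`, a point `y ∈ c`, an inner automorphism `φ = conj q` (given pointwise) with `φ (out c) = y`,
and `m c` invariant: `m.atPoint y = (cosetCongr φ)_* (m c)` — the conjugator `conjOut y` chosen inside ★ `OrbitalMeasureFamily.atPoint` and `q` differ by
`q (conjOut y)⁻¹ ∈ C(y)`, invisible on an invariant measure (★ `map_cosetCongr_centralizer_eq_of_inner`). [cite: Gelbart1975, (9.13); §10 pp. 154–155] -/
theorem OrbitalMeasureFamily.atPoint_eq_map_cosetCongr (y : G) (c : ConjClasses G) (hc : ConjClasses.mk y = c) (φ : G ≃* G)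
    (q : G) (hφ : ∀ g, φ g = q * g * q⁻¹) (hy : φ (Quotient.out c) = y)
    [SMulInvariantMeasure G (G ⧸ Subgroup.centralizer ({(Quotient.out c : G)} : Set G)) (m c)] :
    m.atPoint y = (m c).map (cosetCongr φ (Subgroup.centralizer ({(Quotient.out c : G)} : Set G)) (Subgroup.centralizer ({y} : Set G))
      (forall_apply_mem_centralizer_singleton_iff_of_eq φ hy)) := by
  subst hc
  rw [OrbitalMeasureFamily.atPoint]
  -- `φ = conj u ∘ conj (conjOut y)` with `u := q (conjOut y)⁻¹ ∈ C(y)`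
  refine map_cosetCongr_centralizer_eq_of_inner (MulAut.conj (conjOut y)) φ _ _ (continuous_mulAutConj _) (q * (conjOut y)⁻¹) ?_
    (fun b => ?_) _
  · rw [Subgroup.mem_centralizer_singleton_iff]
    have h1 : y = conjOut y * Quotient.out (ConjClasses.mk y) * (conjOut y)⁻¹ := (conj_conjOut_out y).symm
    have h2 : y = q * Quotient.out (ConjClasses.mk y) * q⁻¹ := by rw [← hφ]; exact hy.symm
    calc q * (conjOut y)⁻¹ * y = q * (conjOut y)⁻¹ * (conjOut y * Quotient.out (ConjClasses.mk y) * (conjOut y)⁻¹) := by rw [← h1]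
      _ = q * Quotient.out (ConjClasses.mk y) * q⁻¹ * (q * (conjOut y)⁻¹) := by group
      _ = y * (q * (conjOut y)⁻¹) := by rw [← h2]
  · rw [hφ, MulAut.conj_apply]
    group

omit [TopologicalSpace G] [IsTopologicalGroup G] [∀ γ : G, MeasurableSpace (G ⧸ Subgroup.centralizer ({γ} : Set G))]
  [∀ γ : G, BorelSpace (G ⧸ Subgroup.centralizer ({γ} : Set G))] in
/-- The class of a conjugate: `⟦k x k⁻¹⟧ = ⟦x⟧` (the conjugacy classes `{γ}` indexing [Gelbart1975, (9.13)]). [cite: Gelbart1975, (9.13)] -/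
theorem conjClassesMk_conj_eq (x k : G) : ConjClasses.mk (k * x * k⁻¹) = ConjClasses.mk x :=
  ConjClasses.mk_eq_mk_iff_isConj.2 (isConj_iff.2 ⟨k⁻¹, by group⟩)

omit [TopologicalSpace G] [IsTopologicalGroup G] [∀ γ : G, MeasurableSpace (G ⧸ Subgroup.centralizer ({γ} : Set G))]
  [∀ γ : G, BorelSpace (G ⧸ Subgroup.centralizer ({γ} : Set G))] in
/-- `conj k` carries `C(x)` onto `C(k x k⁻¹)` (the orbit spaces `G ⧸ G_γ` of [Gelbart1975, (9.13)]). [cite: Gelbart1975, (9.13)] -/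
theorem forall_conj_mem_centralizer_conj_iff (x k : G) :
    ∀ g : G, MulAut.conj k g ∈ Subgroup.centralizer ({k * x * k⁻¹} : Set G) ↔ g ∈ Subgroup.centralizer ({x} : Set G) :=
  forall_apply_mem_centralizer_singleton_iff_of_eq (MulAut.conj k) (MulAut.conj_apply k x)

/-- **`atPoint` at a conjugate point: `m.atPoint (k x k⁻¹) = (cosetCongr (conj k))_* (m.atPoint x)`** for `m⟦x⟧` invariant — the family read at
`k x k⁻¹` (★ `atPoint`, through its own chosen conjugator) IS the family read at `x` pushed along the canonical identification `G ⧸ C(x) ≃ G ⧸ C(k x k⁻¹)`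
induced by `conj k` (§1 `atPoint_eq_map_cosetCongr` at `φ := conj (conjOut x) ≫ conj k`, ★ `cosetCongr_cosetCongr_centralizer`).
[cite: Gelbart1975, (9.13); §10 pp. 154–155] [cite: Rogawski1990, §4.3 p. 44] -/
theorem OrbitalMeasureFamily.atPoint_conj_eq_map (x k : G)
    [SMulInvariantMeasure G (G ⧸ Subgroup.centralizer ({(Quotient.out (ConjClasses.mk x) : G)} : Set G)) (m (ConjClasses.mk x))] :
    m.atPoint (k * x * k⁻¹) = (m.atPoint x).map (cosetCongr (MulAut.conj k) (Subgroup.centralizer ({x} : Set G))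
      (Subgroup.centralizer ({k * x * k⁻¹} : Set G)) (forall_conj_mem_centralizer_conj_iff x k)) := by
  have hy : ((MulAut.conj (conjOut x)).trans (MulAut.conj k)) (Quotient.out (ConjClasses.mk x)) = k * x * k⁻¹ := by
    rw [MulEquiv.trans_apply, conj_conjOut_out, MulAut.conj_apply]
  rw [m.atPoint_eq_map_cosetCongr (k * x * k⁻¹) (ConjClasses.mk x) (conjClassesMk_conj_eq x k) ((MulAut.conj (conjOut x)).trans (MulAut.conj k))
      (k * conjOut x)
      (fun g => by simp only [MulEquiv.trans_apply, MulAut.conj_apply, mul_inv_rev, mul_assoc]) hy,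
    OrbitalMeasureFamily.atPoint,
    Measure.map_map (measurable_cosetCongr (MulAut.conj k) _ _ _ (continuous_mulAutConj k))
      (measurable_cosetCongr (MulAut.conj (conjOut x)) _ _ _ (continuous_mulAutConj (conjOut x)))]
  congr 1
  exact (funext fun z => cosetCongr_cosetCongr_centralizer (MulAut.conj (conjOut x)) (MulAut.conj k) _ _
    (forall_apply_mem_centralizer_singleton_iff_of_eq _ hy) z).symm

/-- **The `π(K)`-mass at a conjugate point**: `(m.atPoint (k x k⁻¹)) (π K) = (m.atPoint x) (π ((conj k)⁻¹ K))` for `m⟦x⟧` invariant and every `K ⊆ G`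
(`cosetCongr (conj k) ⁻¹' π K = π ((conj k) ⁻¹' K)`, ★ `preimage_cosetCongr_image_mk`). [cite: Rogawski1990, §4.3 p. 44] [cite: Gelbart1975, §10 pp. 154–155] -/
theorem OrbitalMeasureFamily.atPoint_conj_apply_image_mk (x k : G)
    [SMulInvariantMeasure G (G ⧸ Subgroup.centralizer ({(Quotient.out (ConjClasses.mk x) : G)} : Set G)) (m (ConjClasses.mk x))] (K : Set G) :
    (m.atPoint (k * x * k⁻¹)) ((QuotientGroup.mk : G → G ⧸ Subgroup.centralizer ({k * x * k⁻¹} : Set G)) '' K) =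
      (m.atPoint x) ((QuotientGroup.mk : G → G ⧸ Subgroup.centralizer ({x} : Set G)) '' ((MulAut.conj k) ⁻¹' K)) := by
  rw [m.atPoint_conj_eq_map x k,
    ← coe_cosetCongrMeasurableEquiv (MulAut.conj k) _ _ (forall_conj_mem_centralizer_conj_iff x k) (continuous_mulAutConj k)
      (continuous_mulAutConj_symm k),
    MeasurableEquiv.map_apply, coe_cosetCongrMeasurableEquiv, preimage_cosetCongr_image_mk (MulAut.conj k) (MulAut.conj_apply k x) K]

omit [TopologicalSpace G] [IsTopologicalGroup G] [∀ γ : G, MeasurableSpace (G ⧸ Subgroup.centralizer ({γ} : Set G))]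
  [∀ γ : G, BorelSpace (G ⧸ Subgroup.centralizer ({γ} : Set G))] in
/-- For a subgroup `K` and `k ∈ K`: `(conj k)⁻¹ K = K` (book-keeping for the `K_v`-masses of [Rogawski1990, §4.3 p. 44]). [cite: Rogawski1990, §4.3 p. 44] -/
theorem preimage_mulAutConj_coe_subgroup_of_mem (K : Subgroup G) {k : G} (hk : k ∈ K) :
    (MulAut.conj k) ⁻¹' (K : Set G) = (K : Set G) := by
  ext g
  simp only [Set.mem_preimage, SetLike.mem_coe, MulAut.conj_apply]
  constructor
  · intro hg
    have h : k⁻¹ * (k * g * k⁻¹) * k ∈ K := K.mul_mem (K.mul_mem (K.inv_mem hk) hg) hk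
    rwa [show k⁻¹ * (k * g * k⁻¹) * k = g by group] at h
  · intro hg
    exact K.mul_mem (K.mul_mem hk hg) (K.inv_mem hk)

/-- **Equal `π(K)`-masses at `x` and at `k x k⁻¹` for `k ∈ K`** (a subgroup; `m⟦x⟧` invariant): `(m.atPoint (k x k⁻¹)) (π K) = (m.atPoint x) (π K)` —
the «mass one on the image of `K_v`» normalisation of a local orbital measure [Rogawski1990, §4.3 p. 44] is insensitive to `K_v`-conjugation of the base
point, with NO canonicity of the family. [cite: Rogawski1990, §4.3 p. 44] [cite: Kottwitz1986, Prop. 7.1] -/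
theorem OrbitalMeasureFamily.atPoint_conj_apply_image_mk_of_mem (x : G) (K : Subgroup G) {k : G} (hk : k ∈ K)
    [SMulInvariantMeasure G (G ⧸ Subgroup.centralizer ({(Quotient.out (ConjClasses.mk x) : G)} : Set G)) (m (ConjClasses.mk x))] :
    (m.atPoint (k * x * k⁻¹)) ((QuotientGroup.mk : G → G ⧸ Subgroup.centralizer ({k * x * k⁻¹} : Set G)) '' (K : Set G)) =
      (m.atPoint x) ((QuotientGroup.mk : G → G ⧸ Subgroup.centralizer ({x} : Set G)) '' (K : Set G)) := by
  rw [m.atPoint_conj_apply_image_mk x k, preimage_mulAutConj_coe_subgroup_of_mem K hk]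

end AtPointConj

/-! ## §2 `U(H)`: `IsNormalisedOff` passes to every adelic point that is `K_v`-conjugate to a normalised one almost everywhere -/

namespace UnitaryGroup

variable (L : Type) [Field L] [NumberField L] [IsCMField L] (N : ℕ) (H : Matrix (Fin N) (Fin N) L)
  [∀ (v : HeightOneSpectrum (𝓞 ↥(maximalRealSubfield L))) (x : (cmDatum L N H).Local v),
    MeasurableSpace ((cmDatum L N H).Local v ⧸ Subgroup.centralizer ({x} : Set ((cmDatum L N H).Local v)))]
  [∀ (v : HeightOneSpectrum (𝓞 ↥(maximalRealSubfield L))) (x : (cmDatum L N H).Local v),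
    BorelSpace ((cmDatum L N H).Local v ⧸ Subgroup.centralizer ({x} : Set ((cmDatum L N H).Local v)))]
  (mG : ∀ v : HeightOneSpectrum (𝓞 ↥(maximalRealSubfield L)), OrbitalMeasureFamily ((cmDatum L N H).Local v))

/-- **Normalisation at a `K_v`-conjugate adelic point, with explicit exceptional sets.**  Local class-indexed families `mG v` on `U(H)(L⁺_v)`; adelic `g`, `y`
with, for every `v ∉ S₀`: `mG` normalised at `g_v` (★ `IsNormalisedOff`: `(mG v).atPoint g_v (π U(H)(𝒪_v)) = 1`), `y_v = k g_v k⁻¹` for some `k ∈ U(H)(𝒪_v)`, and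
`mG v ⟦g_v⟧` invariant.  THEN `mG` is normalised at `y` off `S₀` (§1 `atPoint_conj_apply_image_mk_of_mem` place by place; enlarge `S₀` first if the three
exceptional sets differ — the next theorem).  No canonicity, no compact cores. [cite: Rogawski1990, §4.3 p. 44] [cite: Kottwitz1986, Prop. 7.1] -/
theorem isNormalisedOff_of_forall_exists_mem_conj {g y : (cmDatum L N H).Adelic} {S₀ : Finset (HeightOneSpectrum (𝓞 ↥(maximalRealSubfield L)))}
    (hg : IsNormalisedOff L N H mG g S₀)
    (hconj : ∀ v, v ∉ S₀ → ∃ k ∈ cmLocalIntegralLevel L N H v, k * (cmDatum L N H).toLocal v g * k⁻¹ = (cmDatum L N H).toLocal v y)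
    (hinv : ∀ v, v ∉ S₀ → SMulInvariantMeasure ((cmDatum L N H).Local v)
      ((cmDatum L N H).Local v ⧸ Subgroup.centralizer ({(Quotient.out (ConjClasses.mk ((cmDatum L N H).toLocal v g)) : (cmDatum L N H).Local v)} :
        Set ((cmDatum L N H).Local v))) (mG v (ConjClasses.mk ((cmDatum L N H).toLocal v g)))) :
    IsNormalisedOff L N H mG y S₀ := by
  intro v hv
  obtain ⟨k, hk, hky⟩ := hconj v hv
  haveI := hinv v hv
  rw [← hky, (mG v).atPoint_conj_apply_image_mk_of_mem _ (cmLocalIntegralLevel L N H v) hk]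
  exact hg v hv

/-- **Normalisation at an a.e.-`K_v`-conjugate adelic point** (`∃ S₀` ∕ `∀ᶠ v in cofinite` packaging of the previous theorem): if `mG` is normalised at `g` off
some finite set, `y_v` is `U(H)(𝒪_v)`-conjugate to `g_v` for almost all `v`, and `mG v ⟦g_v⟧` is invariant for almost all `v`, then `mG` is normalised at `y`
off some finite set.  At a semisimple rational `γ₀` the second hypothesis for a matching adèle `y` is ★ K6-α ([Kottwitz1986, Prop. 7.1] in `K_v`-form) and
the third is class-local admissibility — the sequel `Rogawski1990/AdelicNormalisationSemisimple`. [cite: Rogawski1990, §4.3 p. 44] [cite: Kottwitz1986, Prop. 7.1] -/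
theorem exists_isNormalisedOff_of_eventually_exists_mem_conj {g y : (cmDatum L N H).Adelic}
    (hg : ∃ S₀ : Finset (HeightOneSpectrum (𝓞 ↥(maximalRealSubfield L))), IsNormalisedOff L N H mG g S₀)
    (hconj : ∀ᶠ v in cofinite, ∃ k ∈ cmLocalIntegralLevel L N H v, k * (cmDatum L N H).toLocal v g * k⁻¹ = (cmDatum L N H).toLocal v y)
    (hinv : ∀ᶠ v in cofinite, SMulInvariantMeasure ((cmDatum L N H).Local v)
      ((cmDatum L N H).Local v ⧸ Subgroup.centralizer ({(Quotient.out (ConjClasses.mk ((cmDatum L N H).toLocal v g)) : (cmDatum L N H).Local v)} :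
        Set ((cmDatum L N H).Local v))) (mG v (ConjClasses.mk ((cmDatum L N H).toLocal v g)))) :
    ∃ S₁ : Finset (HeightOneSpectrum (𝓞 ↥(maximalRealSubfield L))), IsNormalisedOff L N H mG y S₁ := by
  classical
  obtain ⟨S₀, hS₀⟩ := hg
  rw [Filter.eventually_cofinite] at hconj hinv
  refine ⟨S₀ ∪ hconj.toFinset ∪ hinv.toFinset, isNormalisedOff_of_forall_exists_mem_conj L N H mG (S₀ := S₀ ∪ hconj.toFinset ∪ hinv.toFinset)
    (fun v hv => hS₀ v fun h => hv (Finset.mem_union_left _ (Finset.mem_union_left _ h))) (fun v hv => ?_) (fun v hv => ?_)⟩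
  · by_contra h
    exact hv (Finset.mem_union_left _ (Finset.mem_union_right _ (hconj.mem_toFinset.2 h)))
  · by_contra h
    exact hv (Finset.mem_union_right _ (hinv.mem_toFinset.2 h))

/-! ## §3 (ED. 2) Normalisability is a class invariant among RATIONAL points: the pin at `toAdelic δ` gives the pin at every rational conjugate
`toAdelic γ`, `γ = r δ r⁻¹` (`r ∈ U(H)(L⁺)` is integral at almost every `v`) — so a pin stated at `toAdelic (Quotient.out c)` serves every `γ ∈ c` -/

/-- **`∃ S₀, IsNormalisedOff` passes between RATIONAL CONJUGATES** (any `N`, any `H`): if `γ = r δ r⁻¹` in `U(H)(L⁺)`, `mG` is normalised off a finite set at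
`toAdelic δ`, and `mG v ⟦δ_v⟧` is invariant for almost all `v`, then `mG` is normalised off a finite set at `toAdelic γ` — the rational conjugator `r` lies in
`U(H)(𝒪_v)` for almost all `v` (★ `eventually_toLocal_mem_cmLocalIntegralLevel`), §2 `exists_isNormalisedOff_of_eventually_exists_mem_conj`.
[cite: Rogawski1990, §4.3 p. 44] [cite: Kottwitz1986, Prop. 7.1] -/
theorem exists_isNormalisedOff_toAdelic_of_isConj {δ γ : (cmDatum L N H).Rational} (h : IsConj δ γ)
    (hδ : ∃ S₀ : Finset (HeightOneSpectrum (𝓞 ↥(maximalRealSubfield L))), IsNormalisedOff L N H mG ((cmDatum L N H).toAdelic δ) S₀)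
    (hinv : ∀ᶠ v in cofinite, SMulInvariantMeasure ((cmDatum L N H).Local v)
      ((cmDatum L N H).Local v ⧸ Subgroup.centralizer
        ({(Quotient.out (ConjClasses.mk ((cmDatum L N H).toLocal v ((cmDatum L N H).toAdelic δ))) : (cmDatum L N H).Local v)} : Set ((cmDatum L N H).Local v)))
      (mG v (ConjClasses.mk ((cmDatum L N H).toLocal v ((cmDatum L N H).toAdelic δ))))) :
    ∃ S₁ : Finset (HeightOneSpectrum (𝓞 ↥(maximalRealSubfield L))), IsNormalisedOff L N H mG ((cmDatum L N H).toAdelic γ) S₁ := by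
  obtain ⟨r, hr⟩ := isConj_iff.1 h
  refine exists_isNormalisedOff_of_eventually_exists_mem_conj L N H mG hδ ?_ hinv
  filter_upwards [Rogawski1990.eventually_toLocal_mem_cmLocalIntegralLevel ((cmDatum L N H).toAdelic r)] with v hv
  exact ⟨(cmDatum L N H).toLocal v ((cmDatum L N H).toAdelic r), hv, by rw [← hr, map_mul, map_mul, map_inv, map_inv, map_mul, map_mul]⟩

/-- **The pin at `toAdelic (Quotient.out c)` for every rational class `c` gives the pin at every rational `γ`** (the MAIN-pin shape «`∀ c, ∃ S₀, IsNormalisedOff …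
(toAdelic (out c)) S₀`» read at an arbitrary representative), given a.e. invariance of `mG v` at the local class of `(out ⟦γ⟧)_v`.
[cite: Rogawski1990, §4.3 p. 44] [cite: Kottwitz1986, Prop. 7.1] -/
theorem exists_isNormalisedOff_toAdelic_of_forall_out
    (hpin : ∀ c : ConjClasses (cmDatum L N H).Rational, ∃ S₀ : Finset (HeightOneSpectrum (𝓞 ↥(maximalRealSubfield L))),
      IsNormalisedOff L N H mG ((cmDatum L N H).toAdelic (Quotient.out c)) S₀)
    (γ : (cmDatum L N H).Rational)
    (hinv : ∀ᶠ v in cofinite, SMulInvariantMeasure ((cmDatum L N H).Local v)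
      ((cmDatum L N H).Local v ⧸ Subgroup.centralizer
        ({(Quotient.out (ConjClasses.mk ((cmDatum L N H).toLocal v ((cmDatum L N H).toAdelic (Quotient.out (ConjClasses.mk γ))))) : (cmDatum L N H).Local v)} :
          Set ((cmDatum L N H).Local v)))
      (mG v (ConjClasses.mk ((cmDatum L N H).toLocal v ((cmDatum L N H).toAdelic (Quotient.out (ConjClasses.mk γ))))))) :
    ∃ S₁ : Finset (HeightOneSpectrum (𝓞 ↥(maximalRealSubfield L))), IsNormalisedOff L N H mG ((cmDatum L N H).toAdelic γ) S₁ :=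
  exists_isNormalisedOff_toAdelic_of_isConj L N H mG (Rogawski1990.isConj_out_conjClasses_mk γ).symm (hpin (ConjClasses.mk γ)) hinv

/-- **The same with CLASS-LOCAL ADMISSIBILITY as the invariance source** (the singular heads' binder shape `hadm′`, at `H₁ = H₂ = H`): `mG v` admissible on the local
classes stably conjugate to `γ_v` at every `v` ⟹ the pin at `toAdelic (out ⟦γ⟧)` gives the pin at `toAdelic γ` (`(out ⟦γ⟧)_v ∼_st γ_v`, ★ `corresponds_toLocal_toAdelic`).
[cite: Rogawski1990, §4.3 p. 44; §14.1 p. 232] [cite: Kottwitz1986, Prop. 7.1] -/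
theorem exists_isNormalisedOff_toAdelic_of_forall_out_of_isAdmissibleOn
    (hpin : ∀ c : ConjClasses (cmDatum L N H).Rational, ∃ S₀ : Finset (HeightOneSpectrum (𝓞 ↥(maximalRealSubfield L))),
      IsNormalisedOff L N H mG ((cmDatum L N H).toAdelic (Quotient.out c)) S₀)
    (γ : (cmDatum L N H).Rational)
    (hadm : ∀ v, (mG v).IsAdmissibleOn fun x : (cmDatum L N H).Local v =>
      Rogawski1990.Corresponds (conjLocal L (IsCMField.complexConj L) v) ((adelicForm L N H).map (adeleToLocal L v)) ((adelicForm L N H).map (adeleToLocal L v))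
        ((cmDatum L N H).toLocal v ((cmDatum L N H).toAdelic γ)) x) :
    ∃ S₁ : Finset (HeightOneSpectrum (𝓞 ↥(maximalRealSubfield L))), IsNormalisedOff L N H mG ((cmDatum L N H).toAdelic γ) S₁ :=
  exists_isNormalisedOff_toAdelic_of_forall_out L N H mG hpin γ (Filter.Eventually.of_forall fun v =>
    (hadm v _ ((Rogawski1990.corresponds_toLocal_toAdelic
      (Rogawski1990.isStablyConj_of_isConj (Rogawski1990.isConj_out_conjClasses_mk γ)) v).of_isStablyConj_right
        (Rogawski1990.isStablyConj_of_isConj (Rogawski1990.isConj_out_conjClasses_mk _)))).2.1)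

end UnitaryGroup

end Literature.NumberTheory.Automorphic

end
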